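import Mathlib
import Literature.Computability.Complexity.BooleanFourier
import Literature.Computability.Complexity.BonamiLevelK
import Literature.Analysis.Matrix.BallCarlenLieb
import HarnessLib

/-!
# The hypercontractive inequality for matrix-valued functions (Ben-Aroya–Regev–de Wolf 2008)
# and a dimension-free trace-norm level inequality for psd-contraction fields

Source: A. Ben-Aroya, O. Regev, R. de Wolf, *A hypercontractive inequality for matrix-valued functions
with applications to quantum computing and LDCs*, FOCS 2008 (arXiv:0705.3806) [BenAroyaRegevDeWolf2008].
Their Theorem 1 (§1.1, proved in §3 by induction on `n` from Ball–Carlen–Lieb's optimal 2-uniform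
convexity of the Schatten classes `S_p`, `1 ≤ p ≤ 2`, their Lemma 4): for every `f : {0,1}^n → ℂ^{d×d}`
and `1 ≤ p ≤ 2`,
`(Σ_S (p−1)^{|S|} ‖f̂(S)‖_p²)^{1/2} ≤ (2^{−n} Σ_x ‖f(x)‖_p^p)^{1/p}`,
where `‖M‖_p = ((1/d) Σ_i σ_i(M)^p)^{1/p}` is the NORMALISED Schatten `p`-norm and
`f̂(S) = 2^{−n} Σ_x f(x) χ_S(x)` (entrywise Fourier coefficients, the normalisation of the tree's
`cubeFourierCoeff`). Mathlib has no singular values / Schatten norms; this file states the theorem for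
REAL SYMMETRIC matrix values (where `σ_i = |λ_i|` via `Matrix.IsHermitian.eigenvalues`), which is the case
its consumer needs, as a named fact, and PROVES from it the consequence used for psd-contraction fields.

* `matrixFourierCoeff f S` — the entrywise Fourier coefficient `f̂(S)` of `f : {0,1}^m → ℝ^{d×d}`;
  `isHermitian_matrixFourierCoeff`.
* `schattenNorm A p` — `((1/d) Σ_i |λ_i(A)|^p)^{1/p}` for symmetric `A` (junk value `0` otherwise);
  `traceNorm A = Σ_i |λ_i(A)|`; `schattenNorm_one` (`‖A‖_1 = ‖A‖_tr / d`), `schattenNorm_nonneg`,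
  `schattenNorm_one_le` (power means: `‖A‖_1 ≤ ‖A‖_p`, `p ≥ 1`).
* `BenAroyaRegevDeWolf2008_thm1` — the named fact (Theorem 1, real symmetric case, both sides squared).
* `eigenvalues_le_one`, `schattenNorm_rpow_le_trace_div` — for `0 ⪯ X ⪯ I`: `λ_i(X) ∈ [0,1]` and
  `‖X‖_p^p ≤ tr X / d`.
* `contraction_traceNorm_level_le` — **the dimension-free level inequality** (from the fact): for a
  psd-contraction field `X : {0,1}^m → {0 ⪯ X ⪯ I_d}` and `0 < δ ≤ 1`,
  `Σ_S δ^{|S|} (‖X̂(S)‖_tr / d)² ≤ μ^{2/(1+δ)}`, `μ = 2^{−m} Σ_x tr X_x / d` the density of the field —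
  the scalar Bonami level inequality for a `[0,1]`-valued function of mean `μ` (the case `d = 1`) with
  `f̂(S)²` replaced by `(‖X̂(S)‖_tr/d)²`: the dimension enters only through `μ`
  (cf. [BenAroyaRegevDeWolf2008, Lemma 6], the random-access-code bound `Σ_S δ^{|S|}‖f̂(S)‖_tr² ≤ 2^{2δm}`
  for density-matrix-valued `f`, which is the same computation with `tr f(x) = 1`);
  `contraction_traceNorm_levelK_le` — the single-level form `Σ_{|S|=k} (‖X̂(S)‖_tr/d)² ≤ δ^{−k} μ^{2/(1+δ)}`.
* §6 `BenAroyaRegevDeWolf2008_thm1_iff_twoPoint` — **Theorem 1 is equivalent to its one-bit case**, the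
  Ball–Carlen–Lieb two-point inequality `‖(A+B)/2‖_p² + (p−1)‖(A−B)/2‖_p² ≤ ((‖A‖_p^p + ‖B‖_p^p)/2)^{2/p}`
  for real symmetric `A, B` ([BenAroyaRegevDeWolf2008, Lemma 4] = [BallCarlenLieb1994, Thm. 1] =
  [RicardXu2016, Thm. 1] for one uniform bit): the induction of [BenAroyaRegevDeWolf2008, §3] PROVED
  (`sum_level_schattenNorm_sq_le_of_twoPoint`, via Minkowski in `ℓ_{2/p}`, `weighted_minkowski_rpow`) and
  the converse (`twoPoint_of_sum_level_schattenNorm_sq_le`); so the named fact is localised exactly at the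
  two-matrix inequality.
* §6 (Discharge) `twoPoint_schattenNorm`, **`BenAroyaRegevDeWolf2008_thm1_holds`** — the two-point
  inequality is now PROVED for real symmetric matrices in `Literature/Analysis/Matrix/BallCarlenLieb.lean`
  (`two_point_powerMean`, following [RicardXu2016, §2]); hence the named fact holds.

Consumer: cell pnp-psdrank (summit PneNP, crux `TracialDecayExp20`), where the open step is r-UNIFORMITY of
tracial decay over psd contractions `0 ⪯ X_U ⪯ I_r` (HOME memo LIT-30 §5): the level mass of a contraction
field in the normalisation `‖·‖_tr / r` obeys the classical level-`k` inequalities with the density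
`E tr X / r` in place of the mean, uniformly in `r`.

## References
* [BenAroyaRegevDeWolf2008] A. Ben-Aroya, O. Regev, R. de Wolf, FOCS 2008, Thm. 1 (§1.1, §3), Lemma 4
  (Ball–Carlen–Lieb), Lemma 6 (§4).
* [BallCarlenLieb1994] K. Ball, E. Carlen, E. Lieb, *Sharp uniform convexity and smoothness inequalities
  for trace norms*, Invent. Math. 115 (1994) 463–482, Thm. 1 (the two-point inequality; formalised for real
  symmetric matrices in `Literature/Analysis/Matrix/BallCarlenLieb.lean`, see §6).
* [RicardXu2016] É. Ricard, Q. Xu, *A noncommutative martingale convexity inequality*, Ann. Probab. 44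
  (2016) 867–882, Thm. 1 (`‖x‖_p² ≥ ‖𝓔x‖_p² + (p−1)‖x − 𝓔x‖_p²`, any trace-preserving conditional
  expectation; the two-point inequality is the case of one uniform bit), Cor. 3–4 (iterations).
* [ODonnell2014] R. O'Donnell, *Analysis of Boolean Functions*, CUP 2014, §9.5 (scalar level-k inequalities).
* [HornJohnson2012] R. Horn, C. Johnson, *Matrix Analysis*, 2nd ed., CUP 2012, Thm. 4.2.2 (Rayleigh quotient).
-/

noncomputable section

open Finset Matrix

namespace Literature.Computability.Complexity.MatrixHypercontractivity

open Literature.Computability.Complexity.LowDegree (cubeFourierCoeff)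
open Literature.Probability.RandomGraphs.LowDegree (walsh)

variable {m d : ℕ}

/-! ### §1 Matrix-valued Fourier coefficients -/

/-- The (entrywise) Fourier coefficient `f̂(S) = 2^{-m} Σ_x f(x) χ_S(x)` of a matrix-valued function on the
cube `{0,1}^m`. [cite: BenAroyaRegevDeWolf2008, §1.1 (the Fourier transform of a matrix-valued function, defined entrywise "exactly as before")] -/
def matrixFourierCoeff (f : (Fin m → Bool) → Matrix (Fin d) (Fin d) ℝ) (S : Finset (Fin m)) :
    Matrix (Fin d) (Fin d) ℝ :=
  Matrix.of fun i j => cubeFourierCoeff (fun x => f x i j) S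

/-- Entries of `f̂(S)`. [cite: BenAroyaRegevDeWolf2008, §1.1] -/
theorem matrixFourierCoeff_apply (f : (Fin m → Bool) → Matrix (Fin d) (Fin d) ℝ) (S : Finset (Fin m))
    (i j : Fin d) : matrixFourierCoeff f S i j = cubeFourierCoeff (fun x => f x i j) S := rfl

/-- Fourier coefficients of a symmetric-matrix-valued function are symmetric.
[cite: BenAroyaRegevDeWolf2008, §1.1] -/
theorem isHermitian_matrixFourierCoeff {f : (Fin m → Bool) → Matrix (Fin d) (Fin d) ℝ}
    (hf : ∀ x, (f x).IsHermitian) (S : Finset (Fin m)) : (matrixFourierCoeff f S).IsHermitian := by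
  refine Matrix.IsHermitian.ext fun i j => ?_
  rw [matrixFourierCoeff_apply, matrixFourierCoeff_apply, star_trivial]
  unfold cubeFourierCoeff
  congr 1
  refine Finset.sum_congr rfl fun x _ => ?_
  show f x j i * walsh S x = f x i j * walsh S x
  rw [← (hf x).apply i j, star_trivial]

/-! ### §2 Normalised Schatten norms of symmetric matrices -/

/-- The normalised Schatten `p`-functional `‖A‖_p = ((1/d) Σ_i |λ_i(A)|^p)^{1/p}` of a real symmetric
`d × d` matrix (`|λ_i|` = the singular values); junk value `0` on non-symmetric input.
[cite: BenAroyaRegevDeWolf2008, §1.1 and §2 (normalised Schatten p-norm, ‖A‖_tr = d‖A‖_1)] -/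
def schattenNorm (A : Matrix (Fin d) (Fin d) ℝ) (p : ℝ) : ℝ :=
  if h : A.IsHermitian then ((∑ i, |h.eigenvalues i| ^ p) / d) ^ (1 / p) else 0

/-- The trace norm `‖A‖_tr = Σ_i |λ_i(A)|` of a real symmetric matrix (junk value `0` otherwise).
[cite: BenAroyaRegevDeWolf2008, §2 (‖A‖_tr = Σ σ_i = d·‖A‖_1)] -/
def traceNorm (A : Matrix (Fin d) (Fin d) ℝ) : ℝ :=
  if h : A.IsHermitian then ∑ i, |h.eigenvalues i| else 0

/-- Unfolding `schattenNorm` on a symmetric matrix. [cite: BenAroyaRegevDeWolf2008, §2] -/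
theorem schattenNorm_of_isHermitian {A : Matrix (Fin d) (Fin d) ℝ} (h : A.IsHermitian) (p : ℝ) :
    schattenNorm A p = ((∑ i, |h.eigenvalues i| ^ p) / d) ^ (1 / p) := by
  rw [schattenNorm, dif_pos h]

/-- Unfolding `traceNorm` on a symmetric matrix. [cite: BenAroyaRegevDeWolf2008, §2] -/
theorem traceNorm_of_isHermitian {A : Matrix (Fin d) (Fin d) ℝ} (h : A.IsHermitian) :
    traceNorm A = ∑ i, |h.eigenvalues i| := by
  rw [traceNorm, dif_pos h]

/-- `‖A‖_p ≥ 0`. [cite: BenAroyaRegevDeWolf2008, §2] -/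
theorem schattenNorm_nonneg (A : Matrix (Fin d) (Fin d) ℝ) (p : ℝ) : 0 ≤ schattenNorm A p := by
  unfold schattenNorm
  split_ifs with h
  · exact Real.rpow_nonneg (div_nonneg (Finset.sum_nonneg fun i _ => Real.rpow_nonneg (abs_nonneg _) _)
      (Nat.cast_nonneg _)) _
  · exact le_rfl

/-- `‖A‖_tr ≥ 0`. [cite: BenAroyaRegevDeWolf2008, §2] -/
theorem traceNorm_nonneg (A : Matrix (Fin d) (Fin d) ℝ) : 0 ≤ traceNorm A := by
  unfold traceNorm
  split_ifs with h
  · exact Finset.sum_nonneg fun i _ => abs_nonneg _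
  · exact le_rfl

/-- `‖A‖_1 = ‖A‖_tr / d`. [cite: BenAroyaRegevDeWolf2008, §2 (‖A‖_tr = d‖A‖_1)] -/
theorem schattenNorm_one {A : Matrix (Fin d) (Fin d) ℝ} (h : A.IsHermitian) :
    schattenNorm A 1 = traceNorm A / d := by
  rw [schattenNorm_of_isHermitian h, traceNorm_of_isHermitian h, div_self one_ne_zero, Real.rpow_one]
  simp_rw [Real.rpow_one]

/-- **Monotonicity of normalised Schatten norms** (power means): `‖A‖_1 ≤ ‖A‖_p` for `p ≥ 1`.
[cite: BenAroyaRegevDeWolf2008, §4, proof of Lemma 6 ("by norm monotonicity")] -/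
theorem schattenNorm_one_le {A : Matrix (Fin d) (Fin d) ℝ} (h : A.IsHermitian) (hd : 0 < d) {p : ℝ}
    (hp : 1 ≤ p) : schattenNorm A 1 ≤ schattenNorm A p := by
  rw [schattenNorm_of_isHermitian h, schattenNorm_of_isHermitian h, div_self one_ne_zero, Real.rpow_one]
  have hdR : (0 : ℝ) < d := by exact_mod_cast hd
  have hw : ∑ _i : Fin d, (1 / (d : ℝ)) = 1 := by
    rw [Finset.sum_const, Finset.card_univ, Fintype.card_fin, nsmul_eq_mul]; field_simp
  have key := Real.arith_mean_le_rpow_mean (Finset.univ : Finset (Fin d)) (fun _ => 1 / (d : ℝ))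
    (fun i => |h.eigenvalues i|) (fun _ _ => by positivity) hw (fun _ _ => abs_nonneg _) hp
  have e1 : (∑ i, |h.eigenvalues i| ^ (1 : ℝ)) / (d : ℝ) = ∑ i, 1 / (d : ℝ) * |h.eigenvalues i| := by
    simp_rw [Real.rpow_one]; rw [← Finset.mul_sum, one_div_mul_eq_div]
  have e2 : (∑ i, |h.eigenvalues i| ^ p) / (d : ℝ) = ∑ i, 1 / (d : ℝ) * |h.eigenvalues i| ^ p := by
    rw [← Finset.mul_sum, one_div_mul_eq_div]
  rw [e1, e2]
  exact key

/-! ### §3 The theorem of Ben-Aroya, Regev and de Wolf (named fact) -/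

/-- **Ben-Aroya–Regev–de Wolf 2008, Theorem 1 (hypercontractive inequality for matrix-valued functions)**,
in the special case of REAL SYMMETRIC matrix values and with both sides squared: for every
`f : {0,1}^m → ℝ^{d×d}_sym` (`d ≥ 1`) and `1 ≤ p ≤ 2`,
`Σ_S (p−1)^{|S|} ‖f̂(S)‖_p² ≤ (2^{−m} Σ_x ‖f(x)‖_p^p)^{2/p}`
(normalised Schatten norms). As printed: "For every `f : {0,1}^n → 𝕄` and `1 ≤ p ≤ 2`,
`(Σ_{S⊆[n]} (p−1)^{|S|} ‖f̂(S)‖_p²)^{1/2} ≤ ((1/2^n) Σ_{x∈{0,1}^n} ‖f(x)‖_p^p)^{1/p}`", `𝕄` = the complex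
`d × d` matrices; proof by induction on `n` from the Ball–Carlen–Lieb two-point inequality.
[cite: BenAroyaRegevDeWolf2008, Thm. 1 (§1.1; proof §3, Lemma 4 = Ball–Carlen–Lieb)] -/
def BenAroyaRegevDeWolf2008_thm1 : Prop :=
  ∀ (m d : ℕ), 0 < d → ∀ (f : (Fin m → Bool) → Matrix (Fin d) (Fin d) ℝ), (∀ x, (f x).IsHermitian) →
    ∀ p : ℝ, 1 ≤ p → p ≤ 2 →
      ∑ S : Finset (Fin m), (p - 1) ^ S.card * schattenNorm (matrixFourierCoeff f S) p ^ 2 ≤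
        ((∑ x : Fin m → Bool, schattenNorm (f x) p ^ p) / 2 ^ m) ^ (2 / p)
-- TODO(general form): complex (not necessarily Hermitian) matrix values with singular values, once
-- Mathlib has Schatten norms; the Ball–Carlen–Lieb inequality itself.

/-! ### §4 Psd contractions: eigenvalues in `[0,1]` and `‖X‖_p^p ≤ tr X / d` -/

/-- For `0 ⪯ X ⪯ I` every eigenvalue of `X` is `≤ 1`: the Rayleigh quotient `x*Xx` at a unit eigenvector
is the eigenvalue, and `x*(I − X)x ≥ 0`. [cite: HornJohnson2012, Thm. 4.2.2 (Rayleigh quotient theorem, p. 234: λ = x*Ax for a unit eigenvector x)] -/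
theorem eigenvalues_le_one {X : Matrix (Fin d) (Fin d) ℝ} (hX : X.PosSemidef) (h1 : (1 - X).PosSemidef)
    (i : Fin d) : hX.1.eigenvalues i ≤ 1 := by
  set v : Fin d → ℝ := ⇑(hX.1.eigenvectorBasis i) with hv
  have hq := (Matrix.posSemidef_iff_dotProduct_mulVec.1 h1).2 v
  rw [sub_mulVec, one_mulVec, dotProduct_sub] at hq
  have hnorm : star v ⬝ᵥ v = 1 := by
    have h := hX.1.eigenvectorBasis.orthonormal.1 i
    rw [hv, dotProduct_comm, ← EuclideanSpace.inner_eq_star_dotProduct, real_inner_self_eq_norm_sq, h]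
    norm_num
  have heig : hX.1.eigenvalues i = star v ⬝ᵥ (X *ᵥ v) := by
    rw [hX.1.eigenvalues_eq]; simp [hv]
  linarith

/-- For `0 ⪯ X ⪯ I` and `p ≥ 1`: `‖X‖_p^p = (1/d) Σ λ_i^p ≤ (1/d) Σ λ_i = tr X / d`.
[cite: BenAroyaRegevDeWolf2008, §4, proof of Lemma 6 (‖ρ‖_p^p ≤ 1/2^m for density matrices — the same estimate)] -/
theorem schattenNorm_rpow_le_trace_div {X : Matrix (Fin d) (Fin d) ℝ} (hX : X.PosSemidef)
    (h1 : (1 - X).PosSemidef) {p : ℝ} (hp : 1 ≤ p) :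
    schattenNorm X p ^ p ≤ X.trace / d := by
  have hp0 : 0 < p := by linarith
  rw [schattenNorm_of_isHermitian hX.1]
  have hs : 0 ≤ (∑ i, |hX.1.eigenvalues i| ^ p) / (d : ℝ) :=
    div_nonneg (Finset.sum_nonneg fun i _ => Real.rpow_nonneg (abs_nonneg _) _) (Nat.cast_nonneg _)
  rw [← Real.rpow_mul hs, one_div_mul_cancel hp0.ne', Real.rpow_one]
  have htr : X.trace = ∑ i, hX.1.eigenvalues i := by
    rw [hX.1.trace_eq_sum_eigenvalues]; simp
  rw [htr]
  refine div_le_div_of_nonneg_right (Finset.sum_le_sum fun i _ => ?_) (Nat.cast_nonneg _)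
  have h0 : 0 ≤ hX.1.eigenvalues i := hX.eigenvalues_nonneg i
  have hle : hX.1.eigenvalues i ≤ 1 := eigenvalues_le_one hX h1 i
  rw [abs_of_nonneg h0]
  calc hX.1.eigenvalues i ^ p ≤ hX.1.eigenvalues i ^ (1 : ℝ) :=
        Real.rpow_le_rpow_of_exponent_ge' h0 hle zero_le_one hp
    _ = hX.1.eigenvalues i := Real.rpow_one _

/-! ### §5 The dimension-free trace-norm level inequality for psd-contraction fields -/

/-- **Dimension-free level inequality for psd-contraction fields** (consequence of Theorem 1): for
`X : {0,1}^m → ℝ^{d×d}` with `0 ⪯ X_x ⪯ I` and `0 < δ ≤ 1`,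
`Σ_S δ^{|S|} (‖X̂(S)‖_tr / d)² ≤ μ^{2/(1+δ)}` where `μ = 2^{−m} Σ_x tr X_x / d` is the density of the field.
(Theorem 1 at `p = 1 + δ`, `‖X̂(S)‖_1 ≤ ‖X̂(S)‖_p` and `‖X_x‖_p^p ≤ tr X_x / d`; for `d = 1` this is the
scalar Bonami level inequality for a `[0,1]`-valued function of mean `μ`.)
[cite: BenAroyaRegevDeWolf2008, Thm. 1 and Lemma 6 (the same derivation for density matrices: Σ_S δ^{|S|}‖f̂(S)‖_tr² ≤ 2^{2δm})] -/
theorem contraction_traceNorm_level_le (hfact : BenAroyaRegevDeWolf2008_thm1) (hd : 0 < d)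
    (X : (Fin m → Bool) → Matrix (Fin d) (Fin d) ℝ) (hX : ∀ x, (X x).PosSemidef ∧ (1 - X x).PosSemidef)
    {δ : ℝ} (hδ0 : 0 < δ) (hδ1 : δ ≤ 1) :
    ∑ S : Finset (Fin m), δ ^ S.card * (traceNorm (matrixFourierCoeff X S) / d) ^ 2 ≤
      ((∑ x : Fin m → Bool, (X x).trace / d) / 2 ^ m) ^ (2 / (1 + δ)) := by
  have hp1 : (1 : ℝ) ≤ 1 + δ := by linarith
  have hp2 : 1 + δ ≤ (2 : ℝ) := by linarith
  have hH : ∀ x, (X x).IsHermitian := fun x => (hX x).1.1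
  have h := hfact m d hd X hH (1 + δ) hp1 hp2
  rw [add_sub_cancel_left] at h
  have hS : ∀ S : Finset (Fin m), (traceNorm (matrixFourierCoeff X S) / d) ^ 2 ≤
      schattenNorm (matrixFourierCoeff X S) (1 + δ) ^ 2 := by
    intro S
    have hh := isHermitian_matrixFourierCoeff hH S
    rw [← schattenNorm_one hh]
    exact pow_le_pow_left₀ (schattenNorm_nonneg _ _) (schattenNorm_one_le hh hd hp1) 2
  calc ∑ S : Finset (Fin m), δ ^ S.card * (traceNorm (matrixFourierCoeff X S) / d) ^ 2
      ≤ ∑ S : Finset (Fin m), δ ^ S.card * schattenNorm (matrixFourierCoeff X S) (1 + δ) ^ 2 :=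
        Finset.sum_le_sum fun S _ => mul_le_mul_of_nonneg_left (hS S) (pow_nonneg hδ0.le _)
    _ ≤ ((∑ x : Fin m → Bool, schattenNorm (X x) (1 + δ) ^ (1 + δ)) / 2 ^ m) ^ (2 / (1 + δ)) := h
    _ ≤ ((∑ x : Fin m → Bool, (X x).trace / d) / 2 ^ m) ^ (2 / (1 + δ)) := by
        refine Real.rpow_le_rpow ?_ ?_ (by positivity)
        · exact div_nonneg (Finset.sum_nonneg fun x _ =>
            Real.rpow_nonneg (schattenNorm_nonneg _ _) _) (by positivity)
        · exact div_le_div_of_nonneg_right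
            (Finset.sum_le_sum fun x _ => schattenNorm_rpow_le_trace_div (hX x).1 (hX x).2 hp1)
            (by positivity)

/-- **Single-level form**: `Σ_{|S| = k} (‖X̂(S)‖_tr / d)² ≤ δ^{−k} · μ^{2/(1+δ)}` for every `0 < δ ≤ 1`
(optimising `δ` gives the familiar `μ² (2e ln(1/μ)/k)^k`-type bounds, cf. the scalar
`Literature.Computability.Complexity.LowDegree.levelK_le_log`).
[cite: BenAroyaRegevDeWolf2008, Thm. 1 and Lemma 6] [cite: ODonnell2014, §9.5 (level-k inequalities, scalar case)] -/
theorem contraction_traceNorm_levelK_le (hfact : BenAroyaRegevDeWolf2008_thm1) (hd : 0 < d)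
    (X : (Fin m → Bool) → Matrix (Fin d) (Fin d) ℝ) (hX : ∀ x, (X x).PosSemidef ∧ (1 - X x).PosSemidef)
    {δ : ℝ} (hδ0 : 0 < δ) (hδ1 : δ ≤ 1) (k : ℕ) :
    ∑ S ∈ (Finset.univ : Finset (Finset (Fin m))).filter (fun S => S.card = k),
        (traceNorm (matrixFourierCoeff X S) / d) ^ 2 ≤
      (δ ^ k)⁻¹ * ((∑ x : Fin m → Bool, (X x).trace / d) / 2 ^ m) ^ (2 / (1 + δ)) := by
  have h := contraction_traceNorm_level_le hfact hd X hX hδ0 hδ1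
  have hδk : 0 < δ ^ k := pow_pos hδ0 k
  rw [← div_eq_inv_mul, le_div_iff₀ hδk]
  calc (∑ S ∈ (Finset.univ : Finset (Finset (Fin m))).filter (fun S => S.card = k),
          (traceNorm (matrixFourierCoeff X S) / d) ^ 2) * δ ^ k
      = ∑ S ∈ (Finset.univ : Finset (Finset (Fin m))).filter (fun S => S.card = k),
          δ ^ S.card * (traceNorm (matrixFourierCoeff X S) / d) ^ 2 := by
        rw [Finset.sum_mul]
        refine Finset.sum_congr rfl fun S hS => ?_
        rw [(Finset.mem_filter.1 hS).2, mul_comm]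
    _ ≤ ∑ S : Finset (Fin m), δ ^ S.card * (traceNorm (matrixFourierCoeff X S) / d) ^ 2 :=
        Finset.sum_le_sum_of_subset_of_nonneg (Finset.filter_subset _ _)
          (fun S _ _ => mul_nonneg (pow_nonneg hδ0.le _) (sq_nonneg _))
    _ ≤ _ := h


/-! ### §6 Theorem 1 is equivalent to its one-bit case: the Ball–Carlen–Lieb two-point inequality

[BenAroyaRegevDeWolf2008, §3] proves Theorem 1 by induction on the number of bits from the
case `n = 1`, which is the optimal 2-uniform convexity inequality of Ball, Carlen and Lieb
[BallCarlenLieb1994, Thm. 1] in the form of [BenAroyaRegevDeWolf2008, Lemma 4]: for all matrices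
`A, B` and `1 ≤ p ≤ 2`,
`‖(A+B)/2‖_p² + (p−1) ‖(A−B)/2‖_p² ≤ ((‖A‖_p^p + ‖B‖_p^p)/2)^{2/p}`
(= [RicardXu2016, Thm. 1], `‖x‖_p² ≥ ‖𝓔x‖_p² + (p−1)‖x − 𝓔x‖_p²`, for the conditional expectation
"average over one uniform bit" on `L_∞({0,1}) ⊗ M_d`). The induction step uses only Minkowski's
inequality in `ℓ_{2/p}` [BenAroyaRegevDeWolf2008, Lemma 5]. We formalise the induction (and the
trivial converse), so that the named fact `BenAroyaRegevDeWolf2008_thm1` is KERNEL-EQUIVALENT to the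
single two-matrix inequality (`BenAroyaRegevDeWolf2008_thm1_iff_twoPoint`): a proof of the
Ball–Carlen–Lieb inequality for real symmetric matrices discharges the fact, and nothing less does.
No new named fact is introduced. -/

section TwoPoint

open Literature.Computability.Complexity.LowDegree (sum_cube_succ cubeFourierCoeff_halfSum
  cubeFourierCoeff_halfDiff halfSum halfDiff card_insert_zero_map_succEmb)

/-- Restricting the first bit: `g_b(y) = f(b, y)`. [cite: BenAroyaRegevDeWolf2008, §3, proof of Thm. 1 ("let g_i = f|_{x_{n+1} = i}")] -/
def restrictFirst (f : (Fin (m + 1) → Bool) → Matrix (Fin d) (Fin d) ℝ) (b : Bool)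
    (y : Fin m → Bool) : Matrix (Fin d) (Fin d) ℝ :=
  f (Fin.cons b y)

/-- `g_b(y) = f(b,y)` (unfolding). [cite: BenAroyaRegevDeWolf2008, §3] -/
theorem restrictFirst_apply (f : (Fin (m + 1) → Bool) → Matrix (Fin d) (Fin d) ℝ) (b : Bool)
    (y : Fin m → Bool) : restrictFirst f b y = f (Fin.cons b y) := rfl

/-- **Coefficients not involving the first bit**: `f̂(T⁺) = (ĝ₀(T) + ĝ₁(T))/2`.
[cite: BenAroyaRegevDeWolf2008, §3, proof of Thm. 1 (f̂(S) = ½(ĝ₀(S) + ĝ₁(S)))] -/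
theorem matrixFourierCoeff_map_succEmb (f : (Fin (m + 1) → Bool) → Matrix (Fin d) (Fin d) ℝ)
    (T : Finset (Fin m)) :
    matrixFourierCoeff f (T.map (Fin.succEmb m)) =
      (1 / 2 : ℝ) • (matrixFourierCoeff (restrictFirst f false) T +
        matrixFourierCoeff (restrictFirst f true) T) := by
  ext i j
  simp only [matrixFourierCoeff_apply, Matrix.smul_apply, Matrix.add_apply, smul_eq_mul,
    restrictFirst_apply]
  rw [← cubeFourierCoeff_halfSum (fun x => f x i j) T]
  unfold cubeFourierCoeff halfSum
  have h : ∀ y : Fin m → Bool,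
      (f (Fin.cons false y) i j + f (Fin.cons true y) i j) / 2 *
          Literature.Probability.RandomGraphs.LowDegree.walsh T y =
        1 / 2 * (f (Fin.cons false y) i j * Literature.Probability.RandomGraphs.LowDegree.walsh T y +
          f (Fin.cons true y) i j * Literature.Probability.RandomGraphs.LowDegree.walsh T y) := by
    intro y; ring
  simp_rw [h]
  rw [← Finset.mul_sum, Finset.sum_add_distrib, mul_div_assoc, add_div]

/-- **Coefficients involving the first bit**: `f̂({0} ∪ T⁺) = (ĝ₀(T) − ĝ₁(T))/2`.
[cite: BenAroyaRegevDeWolf2008, §3, proof of Thm. 1 (f̂(S ∪ {n+1}) = ½(ĝ₀(S) − ĝ₁(S)))] -/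
theorem matrixFourierCoeff_insert_zero (f : (Fin (m + 1) → Bool) → Matrix (Fin d) (Fin d) ℝ)
    (T : Finset (Fin m)) :
    matrixFourierCoeff f (insert 0 (T.map (Fin.succEmb m))) =
      (1 / 2 : ℝ) • (matrixFourierCoeff (restrictFirst f false) T -
        matrixFourierCoeff (restrictFirst f true) T) := by
  ext i j
  simp only [matrixFourierCoeff_apply, Matrix.smul_apply, Matrix.sub_apply, smul_eq_mul,
    restrictFirst_apply]
  rw [← cubeFourierCoeff_halfDiff (fun x => f x i j) T]
  unfold cubeFourierCoeff halfDiff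
  have h : ∀ y : Fin m → Bool,
      (f (Fin.cons false y) i j - f (Fin.cons true y) i j) / 2 *
          Literature.Probability.RandomGraphs.LowDegree.walsh T y =
        1 / 2 * (f (Fin.cons false y) i j * Literature.Probability.RandomGraphs.LowDegree.walsh T y -
          f (Fin.cons true y) i j * Literature.Probability.RandomGraphs.LowDegree.walsh T y) := by
    intro y; ring
  simp_rw [h]
  rw [← Finset.mul_sum, Finset.sum_sub_distrib, mul_div_assoc, sub_div]

/-- Subsets of an embedded copy are the embedded copies of subsets. [folklore] -/
private theorem powerset_map_eq {α β : Type*} [DecidableEq β] (e : α ↪ β) (s : Finset α) :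
    (s.map e).powerset = s.powerset.map (Finset.mapEmbedding e).toEmbedding := by
  ext t
  simp only [Finset.mem_powerset, Finset.mem_map, RelEmbedding.coe_toEmbedding,
    Finset.mapEmbedding_apply]
  constructor
  · intro h
    obtain ⟨u, hu, rfl⟩ := Finset.subset_map_iff.1 h
    exact ⟨u, hu, rfl⟩
  · rintro ⟨u, hu, rfl⟩
    exact Finset.map_subset_map.2 hu

/-- **Splitting the sum over `S ⊆ [m+1]` by whether the first coordinate belongs to `S`**:
`Σ_{S ⊆ [m+1]} F(S) = Σ_{T ⊆ [m]} (F(T⁺) + F({0} ∪ T⁺))` (the regrouping of the level sum used in the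
induction step of [BenAroyaRegevDeWolf2008, §3]). [cite: BenAroyaRegevDeWolf2008, §3, proof of Thm. 1 (last display: Σ_{S⊆[n+1]} regrouped as Σ_{S⊆[n]} of the terms at S and S ∪ {n+1})] -/
theorem sum_finset_succ {β : Type*} [AddCommMonoid β] (F : Finset (Fin (m + 1)) → β) :
    ∑ S, F S = ∑ T : Finset (Fin m), (F (T.map (Fin.succEmb m)) + F (insert 0 (T.map (Fin.succEmb m)))) := by
  classical
  have h0 : (0 : Fin (m + 1)) ∉ (Finset.univ : Finset (Fin m)).map (Fin.succEmb m) := by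
    simp only [Finset.mem_map, Finset.mem_univ, true_and, not_exists]
    exact fun i => Fin.succ_ne_zero i
  have huniv : (Finset.univ : Finset (Fin (m + 1))) =
      insert 0 ((Finset.univ : Finset (Fin m)).map (Fin.succEmb m)) := by
    rw [Fin.univ_succ, Finset.cons_eq_insert]
    rfl
  rw [← Finset.powerset_univ, huniv, Finset.sum_powerset_insert h0, powerset_map_eq,
    Finset.sum_map, Finset.sum_map, Finset.powerset_univ, ← Finset.sum_add_distrib]
  rfl

/-- **Minkowski's inequality in `ℓ_r`, `r ≥ 1`, weighted and raised to the `r`-th power**: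
`Σ_i w_i (X_i + Y_i)^r ≤ ((Σ_i w_i X_i^r)^{1/r} + (Σ_i w_i Y_i^r)^{1/r})^r` for `w, X, Y ≥ 0`.
[cite: BenAroyaRegevDeWolf2008, Lemma 5 (Minkowski's inequality, the case q₁ = p, q₂ = 2 used in the proof of Thm. 1)] -/
theorem weighted_minkowski_rpow {ι : Type*} (s : Finset ι) (w X Y : ι → ℝ)
    (hw : ∀ i ∈ s, 0 ≤ w i) (hX : ∀ i ∈ s, 0 ≤ X i) (hY : ∀ i ∈ s, 0 ≤ Y i) {r : ℝ} (hr : 1 ≤ r) :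
    ∑ i ∈ s, w i * (X i + Y i) ^ r ≤
      ((∑ i ∈ s, w i * X i ^ r) ^ (1 / r) + (∑ i ∈ s, w i * Y i ^ r) ^ (1 / r)) ^ r := by
  have hr0 : 0 < r := by linarith
  have key : ∀ i ∈ s, ∀ z : ℝ, 0 ≤ z → (w i ^ (1 / r) * z) ^ r = w i * z ^ r := by
    intro i hi z hz
    rw [Real.mul_rpow (Real.rpow_nonneg (hw i hi) _) hz, ← Real.rpow_mul (hw i hi),
      one_div_mul_cancel hr0.ne', Real.rpow_one]
  have hX' : ∀ i ∈ s, 0 ≤ w i ^ (1 / r) * X i :=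
    fun i hi => mul_nonneg (Real.rpow_nonneg (hw i hi) _) (hX i hi)
  have hY' : ∀ i ∈ s, 0 ≤ w i ^ (1 / r) * Y i :=
    fun i hi => mul_nonneg (Real.rpow_nonneg (hw i hi) _) (hY i hi)
  have hM := Real.Lp_add_le_of_nonneg s hr hX' hY'
  have e1 : ∑ i ∈ s, (w i ^ (1 / r) * X i + w i ^ (1 / r) * Y i) ^ r =
      ∑ i ∈ s, w i * (X i + Y i) ^ r :=
    Finset.sum_congr rfl fun i hi => by
      rw [← mul_add]; exact key i hi (X i + Y i) (add_nonneg (hX i hi) (hY i hi))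
  have e2 : ∑ i ∈ s, (w i ^ (1 / r) * X i) ^ r = ∑ i ∈ s, w i * X i ^ r :=
    Finset.sum_congr rfl fun i hi => key i hi (X i) (hX i hi)
  have e3 : ∑ i ∈ s, (w i ^ (1 / r) * Y i) ^ r = ∑ i ∈ s, w i * Y i ^ r :=
    Finset.sum_congr rfl fun i hi => key i hi (Y i) (hY i hi)
  rw [e1, e2, e3] at hM
  have hS : 0 ≤ ∑ i ∈ s, w i * (X i + Y i) ^ r :=
    Finset.sum_nonneg fun i hi =>
      mul_nonneg (hw i hi) (Real.rpow_nonneg (add_nonneg (hX i hi) (hY i hi)) _)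
  calc ∑ i ∈ s, w i * (X i + Y i) ^ r
      = ((∑ i ∈ s, w i * (X i + Y i) ^ r) ^ (1 / r)) ^ r := by
        rw [← Real.rpow_mul hS, one_div_mul_cancel hr0.ne', Real.rpow_one]
    _ ≤ _ := Real.rpow_le_rpow (Real.rpow_nonneg hS _) hM hr0.le

/-- On the `0`-dimensional cube every Fourier coefficient is the unique value of the function
(plumbing for the base cases). [folklore] -/
private theorem matrixFourierCoeff_fin_zero (g : (Fin 0 → Bool) → Matrix (Fin d) (Fin d) ℝ)
    (T : Finset (Fin 0)) (x : Fin 0 → Bool) : matrixFourierCoeff g T = g x := by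
  have hT : T = ∅ := Subsingleton.elim _ _
  subst hT
  ext i j
  rw [matrixFourierCoeff_apply]
  unfold cubeFourierCoeff
  rw [Fintype.sum_subsingleton _ x]
  simp

/-- **Theorem 1 from its one-bit case** (the induction of [BenAroyaRegevDeWolf2008, §3], dimension by
dimension and exponent by exponent): if the two-point inequality
`‖(A+B)/2‖_p² + (p−1)‖(A−B)/2‖_p² ≤ ((‖A‖_p^p + ‖B‖_p^p)/2)^{2/p}` holds for all real symmetric
`d × d` matrices `A, B` (this is [BallCarlenLieb1994, Thm. 1] = [BenAroyaRegevDeWolf2008, Lemma 4]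
= [RicardXu2016, Thm. 1] for one uniform bit, restricted to real symmetric matrices), then
`Σ_S (p−1)^{|S|} ‖f̂(S)‖_p² ≤ (2^{−m} Σ_x ‖f(x)‖_p^p)^{2/p}` for every `f : {0,1}^m → ℝ^{d×d}_sym`.
Step: split `S` by its first coordinate, apply the two-point inequality to the pair
`(ĝ₀(T), ĝ₁(T))` for every `T ⊆ [m]`, then Minkowski in `ℓ_{2/p}` (`weighted_minkowski_rpow`) and the
induction hypothesis for `g₀, g₁`. [cite: BenAroyaRegevDeWolf2008, Thm. 1, proof in §3 (Lemma 4, Lemma 5)] -/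
theorem sum_level_schattenNorm_sq_le_of_twoPoint (hd : 0 < d) {p : ℝ} (hp1 : 1 ≤ p) (hp2 : p ≤ 2)
    (h2 : ∀ A B : Matrix (Fin d) (Fin d) ℝ, A.IsHermitian → B.IsHermitian →
      schattenNorm ((1 / 2 : ℝ) • (A + B)) p ^ 2 + (p - 1) * schattenNorm ((1 / 2 : ℝ) • (A - B)) p ^ 2 ≤
        ((schattenNorm A p ^ p + schattenNorm B p ^ p) / 2) ^ (2 / p)) :
    ∀ (m : ℕ) (f : (Fin m → Bool) → Matrix (Fin d) (Fin d) ℝ), (∀ x, (f x).IsHermitian) →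
      ∑ S : Finset (Fin m), (p - 1) ^ S.card * schattenNorm (matrixFourierCoeff f S) p ^ 2 ≤
        ((∑ x : Fin m → Bool, schattenNorm (f x) p ^ p) / 2 ^ m) ^ (2 / p)
  | 0, f, hf => by
      have hp0 : 0 < p := by linarith
      rw [Fintype.sum_subsingleton _ (∅ : Finset (Fin 0)),
        Fintype.sum_subsingleton _ (fun _ : Fin 0 => false),
        matrixFourierCoeff_fin_zero f ∅ (fun _ => false), Finset.card_empty, pow_zero, one_mul, pow_zero,
        div_one, ← Real.rpow_mul (schattenNorm_nonneg _ _), mul_div_cancel₀ _ hp0.ne', Real.rpow_two]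
  | m + 1, f, hf => by
      have hp0 : 0 < p := by linarith
      have hq0 : 0 ≤ p - 1 := by linarith
      have _hd := hd
      -- the two halves and the induction hypotheses
      have hgH : ∀ b y, (restrictFirst f b y).IsHermitian := fun b y => hf _
      have ih0 := sum_level_schattenNorm_sq_le_of_twoPoint hd hp1 hp2 h2 m (restrictFirst f false)
        (hgH false)
      have ih1 := sum_level_schattenNorm_sq_le_of_twoPoint hd hp1 hp2 h2 m (restrictFirst f true)
        (hgH true)
      set a : Finset (Fin m) → ℝ := fun T => schattenNorm (matrixFourierCoeff (restrictFirst f false) T) p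
        with ha_def
      set b : Finset (Fin m) → ℝ := fun T => schattenNorm (matrixFourierCoeff (restrictFirst f true) T) p
        with hb_def
      set M0 : ℝ := (∑ y : Fin m → Bool, schattenNorm (restrictFirst f false y) p ^ p) / 2 ^ m
        with hM0_def
      set M1 : ℝ := (∑ y : Fin m → Bool, schattenNorm (restrictFirst f true y) p ^ p) / 2 ^ m
        with hM1_def
      have ha0 : ∀ T, 0 ≤ a T := fun T => schattenNorm_nonneg _ _
      have hb0 : ∀ T, 0 ≤ b T := fun T => schattenNorm_nonneg _ _
      have hM0 : 0 ≤ M0 := div_nonneg (Finset.sum_nonneg fun y _ =>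
        Real.rpow_nonneg (schattenNorm_nonneg _ _) _) (by positivity)
      have hM1 : 0 ≤ M1 := div_nonneg (Finset.sum_nonneg fun y _ =>
        Real.rpow_nonneg (schattenNorm_nonneg _ _) _) (by positivity)
      have hw0 : ∀ T : Finset (Fin m), 0 ≤ (p - 1) ^ T.card := fun T => pow_nonneg hq0 _
      have hpow : ∀ t : ℝ, 0 ≤ t → (t ^ p) ^ (2 / p) = t ^ 2 := fun t ht => by
        rw [← Real.rpow_mul ht, mul_div_cancel₀ _ hp0.ne', Real.rpow_two]
      -- Step 1: split the sum by the first coordinate and rewrite the coefficients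
      rw [sum_finset_succ]
      simp only [Finset.card_map, card_insert_zero_map_succEmb, matrixFourierCoeff_map_succEmb,
        matrixFourierCoeff_insert_zero]
      -- Step 2: the two-point inequality for every `T`
      have step2 : ∀ T : Finset (Fin m),
          (p - 1) ^ T.card * schattenNorm ((1 / 2 : ℝ) • (matrixFourierCoeff (restrictFirst f false) T +
              matrixFourierCoeff (restrictFirst f true) T)) p ^ 2 +
            (p - 1) ^ (T.card + 1) * schattenNorm ((1 / 2 : ℝ) •
              (matrixFourierCoeff (restrictFirst f false) T -
                matrixFourierCoeff (restrictFirst f true) T)) p ^ 2 ≤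
          (p - 1) ^ T.card * ((a T ^ p + b T ^ p) / 2) ^ (2 / p) := by
        intro T
        rw [pow_succ (p - 1) T.card, mul_assoc, ← mul_add]
        exact mul_le_mul_of_nonneg_left (h2 _ _ (isHermitian_matrixFourierCoeff (hgH false) T)
          (isHermitian_matrixFourierCoeff (hgH true) T)) (hw0 T)
      -- Step 3: Minkowski in `ℓ_{2/p}` with weights `(p-1)^{|T|}`
      have hr : 1 ≤ 2 / p := by rw [le_div_iff₀ hp0]; linarith
      have hr0 : 0 < 2 / p := by positivity
      have mink := weighted_minkowski_rpow (Finset.univ : Finset (Finset (Fin m)))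
        (fun T => (p - 1) ^ T.card) (fun T => a T ^ p) (fun T => b T ^ p) (fun T _ => hw0 T)
        (fun T _ => Real.rpow_nonneg (ha0 T) _) (fun T _ => Real.rpow_nonneg (hb0 T) _) hr
      have eA : ∑ T, (p - 1) ^ T.card * (a T ^ p) ^ (2 / p) =
          ∑ T, (p - 1) ^ T.card * schattenNorm (matrixFourierCoeff (restrictFirst f false) T) p ^ 2 :=
        Finset.sum_congr rfl fun T _ => by rw [hpow _ (ha0 T)]
      have eB : ∑ T, (p - 1) ^ T.card * (b T ^ p) ^ (2 / p) =
          ∑ T, (p - 1) ^ T.card * schattenNorm (matrixFourierCoeff (restrictFirst f true) T) p ^ 2 :=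
        Finset.sum_congr rfl fun T _ => by rw [hpow _ (hb0 T)]
      rw [eA, eB] at mink
      -- the induction hypotheses, raised to the power `p/2 = 1/(2/p)`
      have hinv : 1 / (2 / p) = p / 2 := by rw [one_div_div]
      have hA : (∑ T, (p - 1) ^ T.card *
          schattenNorm (matrixFourierCoeff (restrictFirst f false) T) p ^ 2) ^ (1 / (2 / p)) ≤ M0 := by
        have h := Real.rpow_le_rpow (Finset.sum_nonneg fun T _ => mul_nonneg (hw0 T) (sq_nonneg _))
          ih0 (show (0 : ℝ) ≤ 1 / (2 / p) by positivity)
        rwa [← Real.rpow_mul hM0, mul_one_div, div_self (by positivity : (2 : ℝ) / p ≠ 0), Real.rpow_one]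
          at h
      have hB : (∑ T, (p - 1) ^ T.card *
          schattenNorm (matrixFourierCoeff (restrictFirst f true) T) p ^ 2) ^ (1 / (2 / p)) ≤ M1 := by
        have h := Real.rpow_le_rpow (Finset.sum_nonneg fun T _ => mul_nonneg (hw0 T) (sq_nonneg _))
          ih1 (show (0 : ℝ) ≤ 1 / (2 / p) by positivity)
        rwa [← Real.rpow_mul hM1, mul_one_div, div_self (by positivity : (2 : ℝ) / p ≠ 0), Real.rpow_one]
          at h
      -- the right-hand side, split by the first coordinate
      have hrhs : (∑ x : Fin (m + 1) → Bool, schattenNorm (f x) p ^ p) / 2 ^ (m + 1) = (M0 + M1) / 2 := by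
        rw [sum_cube_succ (fun x => schattenNorm (f x) p ^ p), Finset.sum_add_distrib, pow_succ,
          ← div_div, add_div]
        rfl
      rw [hrhs]
      -- assemble
      calc ∑ T : Finset (Fin m),
            ((p - 1) ^ T.card * schattenNorm ((1 / 2 : ℝ) • (matrixFourierCoeff (restrictFirst f false) T +
                matrixFourierCoeff (restrictFirst f true) T)) p ^ 2 +
              (p - 1) ^ (T.card + 1) * schattenNorm ((1 / 2 : ℝ) •
                (matrixFourierCoeff (restrictFirst f false) T -
                  matrixFourierCoeff (restrictFirst f true) T)) p ^ 2)
          ≤ ∑ T, (p - 1) ^ T.card * ((a T ^ p + b T ^ p) / 2) ^ (2 / p) := Finset.sum_le_sum fun T _ => step2 T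
        _ = (1 / 2) ^ (2 / p) * ∑ T, (p - 1) ^ T.card * (a T ^ p + b T ^ p) ^ (2 / p) := by
            rw [Finset.mul_sum]
            refine Finset.sum_congr rfl fun T _ => ?_
            rw [div_eq_mul_one_div (a T ^ p + b T ^ p), Real.mul_rpow
              (add_nonneg (Real.rpow_nonneg (ha0 T) _) (Real.rpow_nonneg (hb0 T) _))
              (by norm_num : (0 : ℝ) ≤ 1 / 2)]
            ring
        _ ≤ (1 / 2) ^ (2 / p) * (M0 + M1) ^ (2 / p) := by
            refine mul_le_mul_of_nonneg_left (mink.trans ?_) (by positivity)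
            exact Real.rpow_le_rpow (by positivity) (add_le_add hA hB) hr0.le
        _ = ((M0 + M1) / 2) ^ (2 / p) := by
            rw [div_eq_mul_one_div (M0 + M1), Real.mul_rpow (add_nonneg hM0 hM1)
              (by norm_num : (0 : ℝ) ≤ 1 / 2)]
            ring

/-- **The one-bit case from Theorem 1** (converse direction): Theorem 1 for `m = 1` and
`f(0) = A`, `f(1) = B` is the two-point inequality, since `f̂(∅) = (A+B)/2` and `f̂({0}) = (A−B)/2`.
[cite: BenAroyaRegevDeWolf2008, §3, proof of Thm. 1 ("The case n = 1 follows from Lemma 4 by setting A = f(0) and B = f(1)")] -/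
theorem twoPoint_of_sum_level_schattenNorm_sq_le {p : ℝ}
    (h : ∀ (m : ℕ) (f : (Fin m → Bool) → Matrix (Fin d) (Fin d) ℝ), (∀ x, (f x).IsHermitian) →
      ∑ S : Finset (Fin m), (p - 1) ^ S.card * schattenNorm (matrixFourierCoeff f S) p ^ 2 ≤
        ((∑ x : Fin m → Bool, schattenNorm (f x) p ^ p) / 2 ^ m) ^ (2 / p))
    (A B : Matrix (Fin d) (Fin d) ℝ) (hA : A.IsHermitian) (hB : B.IsHermitian) :
    schattenNorm ((1 / 2 : ℝ) • (A + B)) p ^ 2 + (p - 1) * schattenNorm ((1 / 2 : ℝ) • (A - B)) p ^ 2 ≤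
      ((schattenNorm A p ^ p + schattenNorm B p ^ p) / 2) ^ (2 / p) := by
  set f : (Fin 1 → Bool) → Matrix (Fin d) (Fin d) ℝ := fun x => if x 0 then B else A with hf_def
  have hf : ∀ x, (f x).IsHermitian := by
    intro x; simp only [hf_def]; split_ifs <;> assumption
  have key := h 1 f hf
  have e0 : f (Fin.cons false fun _ => false) = A := by simp [hf_def]
  have e1 : f (Fin.cons true fun _ => false) = B := by simp [hf_def]
  have h0 : restrictFirst f false (fun _ => false) = A := e0
  have h1 : restrictFirst f true (fun _ => false) = B := e1
  rw [sum_finset_succ, Fintype.sum_subsingleton _ (∅ : Finset (Fin 0)), matrixFourierCoeff_map_succEmb,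
    matrixFourierCoeff_insert_zero, matrixFourierCoeff_fin_zero _ ∅ (fun _ => false),
    matrixFourierCoeff_fin_zero _ ∅ (fun _ => false), h0, h1, Finset.card_map,
    card_insert_zero_map_succEmb, Finset.card_empty, sum_cube_succ (fun x => schattenNorm (f x) p ^ p),
    Fintype.sum_subsingleton _ (fun _ : Fin 0 => false), e0, e1, pow_zero, one_mul, zero_add, pow_one,
    pow_one] at key
  exact key

/-- **Ben-Aroya–Regev–de Wolf's Theorem 1 is equivalent to the Ball–Carlen–Lieb two-point inequality**
(both for real symmetric matrices, normalised Schatten norms): `BenAroyaRegevDeWolf2008_thm1` holds iff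
for every `d ≥ 1`, `1 ≤ p ≤ 2` and real symmetric `A, B`,
`‖(A+B)/2‖_p² + (p−1)‖(A−B)/2‖_p² ≤ ((‖A‖_p^p + ‖B‖_p^p)/2)^{2/p}`.
The right-hand side is, verbatim for real symmetric matrices, [BenAroyaRegevDeWolf2008, Lemma 4]
(= the optimal 2-uniform convexity inequality of [BallCarlenLieb1994] for `S_p`, `1 ≤ p ≤ 2`, in the
power-mean form also quoted as [ArunachalamDoriguello2024, Thm. 3]; = the case
"`𝓜 = L_∞({0,1}) ⊗ M_d`, `𝓔` = average over the bit" of [RicardXu2016, Thm. 1]); so the tree's one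
matrix-analysis fact is localised exactly at that inequality.
[cite: BenAroyaRegevDeWolf2008, Thm. 1 and Lemma 4 (§3)] [cite: BallCarlenLieb1994, Thm. 1 (optimal 2-uniform convexity of C_p, 1 ≤ p ≤ 2)] [cite: ArunachalamDoriguello2024, Thm. 3 (§3.1, the Ball–Carlen–Lieb inequality as quoted)] [cite: RicardXu2016, Thm. 1] -/
theorem BenAroyaRegevDeWolf2008_thm1_iff_twoPoint :
    BenAroyaRegevDeWolf2008_thm1 ↔
      ∀ d : ℕ, 0 < d → ∀ p : ℝ, 1 ≤ p → p ≤ 2 → ∀ A B : Matrix (Fin d) (Fin d) ℝ,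
        A.IsHermitian → B.IsHermitian →
          schattenNorm ((1 / 2 : ℝ) • (A + B)) p ^ 2 +
              (p - 1) * schattenNorm ((1 / 2 : ℝ) • (A - B)) p ^ 2 ≤
            ((schattenNorm A p ^ p + schattenNorm B p ^ p) / 2) ^ (2 / p) := by
  constructor
  · intro h d hd p hp1 hp2 A B hA hB
    exact twoPoint_of_sum_level_schattenNorm_sq_le (fun m f hf => h m d hd f hf p hp1 hp2) A B hA hB
  · intro h m d hd f hf p hp1 hp2
    exact sum_level_schattenNorm_sq_le_of_twoPoint hd hp1 hp2 (h d hd p hp1 hp2) m f hf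

end TwoPoint

/-! ### §6 The named fact discharged: Ball–Carlen–Lieb for real symmetric matrices -/

section Discharge

open Literature.Analysis.Matrix.BallCarlenLieb (trAbsPow trAbsPow_eq_sum trAbsPow_nonneg two_point_powerMean)

/-- `‖A‖_p = (Tr|A|^p / d)^{1/p}` for real symmetric `A`: the normalised Schatten functional through the
trace power `trAbsPow` of `Literature/Analysis/Matrix/BallCarlenLiebKey.lean`.
[cite: BenAroyaRegevDeWolf2008, §2 (normalised Schatten p-norm)] -/
theorem schattenNorm_eq_trAbsPow {d : ℕ} {A : Matrix (Fin d) (Fin d) ℝ} (h : A.IsHermitian) (p : ℝ) :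
    schattenNorm A p = (trAbsPow p A / d) ^ (1 / p) := by
  rw [schattenNorm_of_isHermitian h, trAbsPow_eq_sum p h]

/-- **The Ball–Carlen–Lieb two-point inequality in the normalised Schatten norms** (real symmetric
`d × d` matrices, `d ≥ 1`, `1 ≤ p ≤ 2`):
`‖(A+B)/2‖_p² + (p−1)‖(A−B)/2‖_p² ≤ ((‖A‖_p^p + ‖B‖_p^p)/2)^{2/p}` — the power-mean form
`Literature.Analysis.Matrix.BallCarlenLieb.two_point_powerMean` with `X = (A+B)/2`, `Y = (A−B)/2`,
divided by `d^{2/p}`.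
[cite: BenAroyaRegevDeWolf2008, Lemma 4 (§3)] [cite: BallCarlenLieb1994, Thm. 1] -/
theorem twoPoint_schattenNorm {d : ℕ} (hd : 0 < d) {p : ℝ} (hp1 : 1 ≤ p) (hp2 : p ≤ 2)
    {A B : Matrix (Fin d) (Fin d) ℝ} (hA : A.IsHermitian) (hB : B.IsHermitian) :
    schattenNorm ((1 / 2 : ℝ) • (A + B)) p ^ 2 + (p - 1) * schattenNorm ((1 / 2 : ℝ) • (A - B)) p ^ 2 ≤
      ((schattenNorm A p ^ p + schattenNorm B p ^ p) / 2) ^ (2 / p) := by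
  haveI : Nonempty (Fin d) := ⟨⟨0, hd⟩⟩
  have hp0 : 0 < p := by linarith
  have hd0 : (0 : ℝ) < d := Nat.cast_pos.2 hd
  set X := (1 / 2 : ℝ) • (A + B) with hXdef
  set Y := (1 / 2 : ℝ) • (A - B) with hYdef
  have hsymm : ∀ {M : Matrix (Fin d) (Fin d) ℝ}, M.IsHermitian ↔ Mᵀ = M := by
    intro M
    unfold Matrix.IsHermitian
    have : Mᴴ = Mᵀ := by ext i j; simp [Matrix.conjTranspose_apply]
    rw [this]
  have hA' := hsymm.1 hA
  have hB' := hsymm.1 hB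
  have hX : X.IsHermitian := hsymm.2 (by rw [hXdef, transpose_smul, transpose_add, hA', hB'])
  have hY : Y.IsHermitian := hsymm.2 (by rw [hYdef, transpose_smul, transpose_sub, hA', hB'])
  have eXY : X + Y = A := by rw [hXdef, hYdef]; module
  have eXY' : X - Y = B := by rw [hXdef, hYdef]; module
  have key := two_point_powerMean hX hY hp1 hp2
  rw [eXY, eXY'] at key
  -- rewrite the normalised norms through `trAbsPow`
  have hSX := trAbsPow_nonneg p hX
  have hSY := trAbsPow_nonneg p hY
  have hSA := trAbsPow_nonneg p hA
  have hSB := trAbsPow_nonneg p hB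
  have sq : ∀ {M : Matrix (Fin d) (Fin d) ℝ} (hM : M.IsHermitian),
      schattenNorm M p ^ 2 = (trAbsPow p M / d) ^ (2 / p) := by
    intro M hM
    have hu : 0 ≤ trAbsPow p M / d := div_nonneg (trAbsPow_nonneg p hM) hd0.le
    rw [schattenNorm_eq_trAbsPow hM, ← Real.rpow_natCast, ← Real.rpow_mul hu]
    congr 1
    push_cast
    ring
  have pw : ∀ {M : Matrix (Fin d) (Fin d) ℝ} (hM : M.IsHermitian),
      schattenNorm M p ^ p = trAbsPow p M / d := by
    intro M hM
    have hu : 0 ≤ trAbsPow p M / d := div_nonneg (trAbsPow_nonneg p hM) hd0.le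
    rw [schattenNorm_eq_trAbsPow hM, ← Real.rpow_mul hu, one_div_mul_cancel hp0.ne', Real.rpow_one]
  rw [sq hX, sq hY, pw hA, pw hB, Real.div_rpow hSX hd0.le, Real.div_rpow hSY hd0.le]
  have e : (trAbsPow p A / d + trAbsPow p B / d) / 2 = ((trAbsPow p A + trAbsPow p B) / 2) / d := by
    field_simp
  rw [e, Real.div_rpow (by positivity) hd0.le]
  have hdq : 0 < (d : ℝ) ^ (2 / p) := Real.rpow_pos_of_pos hd0 _
  have e2 : trAbsPow p X ^ (2 / p) / (d : ℝ) ^ (2 / p) + (p - 1) * (trAbsPow p Y ^ (2 / p) / (d : ℝ) ^ (2 / p))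
      = (trAbsPow p X ^ (2 / p) + (p - 1) * trAbsPow p Y ^ (2 / p)) / (d : ℝ) ^ (2 / p) := by ring
  rw [e2]
  exact div_le_div_of_nonneg_right key hdq.le

/-- **Discharge of the named fact `BenAroyaRegevDeWolf2008_thm1`** (Ben-Aroya–Regev–de Wolf 2008,
Thm. 1, real symmetric matrix values): by `BenAroyaRegevDeWolf2008_thm1_iff_twoPoint` it is equivalent
to the Ball–Carlen–Lieb two-point inequality, proved for real symmetric matrices in
`Literature/Analysis/Matrix/BallCarlenLieb.lean`.
[cite: BenAroyaRegevDeWolf2008, Thm. 1 (§1.1; proof §3 via Lemma 4)] [cite: BallCarlenLieb1994, Thm. 1] -/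
theorem BenAroyaRegevDeWolf2008_thm1_holds : BenAroyaRegevDeWolf2008_thm1 :=
  BenAroyaRegevDeWolf2008_thm1_iff_twoPoint.2 fun _ hd _ hp1 hp2 _ _ hA hB =>
    twoPoint_schattenNorm hd hp1 hp2 hA hB

end Discharge

end Literature.Computability.Complexity.MatrixHypercontractivity
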